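import Literature.MathematicalPhysics.QuantumFieldTheory.Balaban1983to89.B9Thm314WholeCancellationPair
import Literature.MathematicalPhysics.QuantumFieldTheory.Balaban1983to89.B9Thm315WholeSectE
import Literature.MathematicalPhysics.QuantumFieldTheory.Balaban1983to89.Node00.OpsYRecordV4

/-!
# `Balaban1983to89.B9Thm314Thm315RecordV4` — ROWS 22–24 OF THE N06 CERTIFICATE AT def-Y v4's INSTANCE OF RECORD `Node00.opsYOfRecordV4E`
# (symmetrised site transporters `parSymY`; GENUINE `Kdiff = KdiffSY`, GENUINE `C^{(k)}(Λ) = CkY` with the pinned Theorem-3.15 slots)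

T. Bałaban, *Propagators for lattice gauge theories in a background field*, Commun. Math. Phys. **99** (1985) 389–434
[`Balaban1985BackgroundPropagators`, "B9"].

statement-level skeleton of published theorems with citation tags; proofs where landed; nothing here is a claim about the Yang–Mills mass gap

THE PRINTED LOCI (verbatim).  Theorem 3.14, p. 427: *"If we take a pair of operators constructed for the two sequences {Ω_j}, {Ω′_j}, then their
difference satisfies all the inequalities characteristic for operators of the considered type, with the additional factor exp(−δ₀d(y, y′, Ω)) …"*;
its proof, p. 427: *"We take random walk expansions for both operators. … in the difference they are cancelled …"*; Theorem 3.15, p. 432: *"For Mα₀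
sufficiently small the propagator C^{(k)}(Λ) is given by the formula (3.185), and satisfies the bound |C^{(k)}(Λ; y, y′)| ≤ B₀e^{−δ₀|y−y′|}, y, y′ ∈ Λ
(3.187) … This propagator has a convergent random walk expansion of the type described previously."*

THE POINT.  def-Y g4's `Node00.OpsYRecordV4` (p500763) re-issues the instance of record over the SYMMETRISED site transporter `parSymY` (the R7
repair: (3.24)'s adjoint form of the block averages): letters `lettersYOfRecordV4 N θ M⋆ 𝔯` (Theorem-3.14 letter `Kdiff = KdiffSY = GAv4Y − GAsndSY`,
`lettersYOfRecordV4`/`covLettersY_v4_Kdiff`), base layer `opsYS349OfRecordV4` (dag-n06-i's genuine (3.49) reading) and ★ `opsYOfRecordV4E N θ M⋆ 𝔯 𝔢 𝔴 𝔈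
:= opsYSectE … (opsYS349OfRecordV4 …) (lettersYOfRecordV4 …) 𝔢 𝔴` (def-Y g4's Sect. E update: `Ck` = the index-bond kernel of `CkY` defined by
(3.156)–(3.158), slots `givenBy3185Y` ∕ `hasRWExpCY` pinned).  The seat's row faces are GENERIC in the letters (`B9Thm314WholeCancellationLayer.
thm314_pair_layerOfLetters`, `B9Thm315WholeSectE.t315_opsYSectE_of_reading`, `B9Thm315WholeSectERep.t315_opsYSectE_of_3185`); THIS FILE states them at
the v4 record with the binders VERBATIM, for dag-n06-d's knit at `ops := Node00.opsYOfRecordV4E …` to consume BY NAME (the v3 twins: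
`B9Thm314Thm315RecordDE`, `B9Thm314WholeCancellationPair` §4, `B9Thm315WholeSectE` §4):
* §1 rows 22 ∧ 23: `opsYOfRecordV4E_Kdiff` (`rfl`: def-Y's bond-sector reading `kernelFamilyB` of the GENUINE letter `KdiffSY`), ★★ `thm314_pair_opsYOfRecordV4E`
  (`t314 ∧ t314loc` through the cancellation reading PROVED — displayed: the two sequences' walk-term letters `T₁ T₂` with their Theorem-3.10 all-norms
  leaves `h₁ h₂` read through `kernelFamilyB`, the localisation data `X₁ M₁ X₂ M₂ diam` with the laws `near ∕ first ∕ chain`, the M-uniform diameter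
  bound `hr` (flag T314 (ii) STANDS), per-sequence walk sets `W₁ W₂` with `WalkSetsSpec ∕ WalkWeightsSummable`, and the located approximation identity
  `hexp` for `KdiffSY`), ★★ `thm314_pair_opsYOfRecordV4E_of_cancel` (`hexp` SUPPLIED from per-sequence eventual readings `hE₁ hE₂` of `GAv4Y`, `GAsndSY`
  and the inner-term agreement `hcancel` — «in the difference they are cancelled», `B9Thm314WholeCancellationPair.expansionReads_sub_of_cancel`).
* §2 row 24: ★★ `t315_opsYOfRecordV4E_of_reading` — the binder `t315` VERBATIM (the left-hand side of def-Y's `t315_opsYOfRecordV4E_iff`), the bound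
  (3.187) PROVED through the expansion slot (`B9Thm315WholeSectE.t315_opsYSectE_of_reading`: the two pinned slots on the printed prefix, the located
  kernel reading `KernelDominated`, the walk count `KWalkCount`, uniform term constants, the floor `2D₀c₀ ≤ M⋆`).  The face through the (3.185) slot
  is `B9Thm315WholeSectERep.t315_opsYOfRecordV4E_of_3185`.

HONEST SCOPE.  Count-neutral kernel bookkeeping (instantiation by `rfl` of landed generic faces); every displayed hypothesis is operator-level data
about def-Y's genuine letters (`KdiffSY`, `CkY` over `lettersYOfRecordV4`, the residual Sect. E letters `𝔢`, the walk letters `𝔴`) of printed ∕ located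
shape; nothing of print asserted; NOT a node discharge (N06 unmoved), NOT summit progress; one finite lattice programme at fixed ε; nothing continuum
∕ ℝ⁴ ∕ OS ∕ mass gap ∕ Clay.  Cell `pub-ymgap` (D-0062), node N06 [B9], N06-ASSIGNMENT bundle F8 rows 22–24 (successor file), seat `pub-ymgap-dag-n06-m`
(g4), 2026-08-27.  Imports the seat's `B9Thm314WholeCancellationPair`, `B9Thm315WholeSectE` and def-Y's `Node00.OpsYRecordV4`; nothing restated.
-/

noncomputable section

namespace Literature.MathematicalPhysics.QuantumFieldTheory.Balaban1983to89.B9Thm314Thm315RecordV4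

open B9 B9Thm314 B9FromB6ModelSignsOn
open B6KLevelCensusIndexV1 (KIdx)
open B9GeoNormsKLevelModelSignsV1 (modelSignsOn_geo9K)
open B9PinMembersKLevelV1 (MemberY geo9Y bg9Y)
open B9PinGeometryKLevelV1 (kLab dOmegaY OmKY dOmegaY_nonneg c35Y inΛY unitDistY)
open B9Thm314GpFlatTorusGeometry (tdistK OmegaC)
open B9Thm314WholePinGeometry (locDataY locDataY_laws)
open B9Thm314WholePair (locData₂)
open B9Thm314WholePairWalks (pairWalkSets)
open B9Thm314WholeSummation (WalkSetsSpec WalkWeightsSummable)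
open B9SectCWalkTermsAllNorms (Thm310AllNormsPrinted)
open B9Thm314WholeExpansionReads (ExpansionReads)
open B9Thm314WholeCancellationLayer (pairOp thm314_pair_layerOfLetters)
open B9Thm314WholeCancellationPair (negOp ExpansionReadsEv InnerTermsAgree expansionReads_sub_of_cancel)
open B9Thm315WholeSectE (KernelDominated KWalkCount t315_opsYSectE_of_reading)
open B7Prop2SpecialUnitary (specialUnitaryUnits)
open Node00 (BondOpY kernelFamilyB siteKernelOfOp CkY givenBy3185Y hasRWExpCY Stage3Params ExpsY ResY SectEY RWEY GAv4Y GAsndSY KdiffSY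
  lettersYOfRecordV4 opsYS349OfRecordV4 opsYOfRecordV4E)

open scoped Matrix.Norms.L2Operator

variable (N : ℕ) (θ : Stage3Params) (Mstar : ℕ) (𝔯 : ResY N θ Mstar) (𝔢 : SectEY N θ Mstar) (𝔴 : RWEY N θ Mstar) (𝔈 : ExpsY N θ Mstar)

/-! ## §1 Rows 22 ∧ 23 at the v4 record: the genuine letter `KdiffSY` through the cancellation reading -/

/-- the `Kdiff` family of the v4 record IS def-Y's bond-sector reading of the GENUINE letter `KdiffSY` (G for {Ω_j} minus G for {Ω′_j}, symmetrised
transporters). [cite: Balaban1985BackgroundPropagators, Thm 3.14 pp.426–427, bookkeeping] -/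
theorem opsYOfRecordV4E_Kdiff (x : MemberY θ.d₆ θ.ℓ₆ θ.hd' θ.hL' θ.b₀ θ.b₁ Mstar) :
    (opsYOfRecordV4E N θ Mstar 𝔯 𝔢 𝔴 𝔈 x).Kdiff =
      kernelFamilyB x.toKIdx (bg9Y (Matrix (Fin N) (Fin N) ℂ) (specialUnitaryUnits (Fin N)) x) (fun U => U)
        (KdiffSY (Matrix (Fin N) (Fin N) ℂ) x) (lettersYOfRecordV4 N θ Mstar 𝔯 x).parB := rfl

/-- ★★ **ROWS 22 ∧ 23 (`t314`, `t314loc`) AT def-Y v4's INSTANCE OF RECORD, THE CANCELLATION READING PROVED**: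
`B9Thm314WholeCancellationLayer.thm314_pair_layerOfLetters` at `𝔏 := lettersYOfRecordV4 N θ M⋆ 𝔯` with the geometry pinned by `locDataY ∕ locDataY_laws`
and the signs by `modelSignsOn_geo9K`.  Displayed (operator-level, about the genuine letter `KdiffSY … x`): the two sequences' walk-term letters `T₁ T₂`
with their Theorem-3.10 all-norms leaves `h₁ h₂` (read through `kernelFamilyB`), the localisation data `X₁ M₁ X₂ M₂ diam` with the laws `near ∕ first ∕
chain`, the M-uniform diameter bound `hr` (flag T314 (ii) STANDS), the per-sequence walk sets `W₁ W₂` with `WalkSetsSpec ∕ WalkWeightsSummable`, and the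
located approximation identity `hexp` for `KdiffSY` under «both expansions converge at U».  NOT a node discharge.
[cite: Balaban1985BackgroundPropagators, Thm 3.14 (3.154) pp.426–427] -/
theorem thm314_pair_opsYOfRecordV4E
    {E₁ E₂ : ∀ x : MemberY θ.d₆ θ.ℓ₆ θ.hd' θ.hL' θ.b₀ θ.b₁ Mstar,
      B9.RWExpansion (geo9Y x) (bg9Y (Matrix (Fin N) (Fin N) ℂ) (specialUnitaryUnits (Fin N)) x)}
    (T₁ : ∀ x : MemberY θ.d₆ θ.ℓ₆ θ.hd' θ.hL' θ.b₀ θ.b₁ Mstar, (E₁ x).Walk → BondOpY (Matrix (Fin N) (Fin N) ℂ) x.toKIdx)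
    (T₂ : ∀ x : MemberY θ.d₆ θ.ℓ₆ θ.hd' θ.hL' θ.b₀ θ.b₁ Mstar, (E₂ x).Walk → BondOpY (Matrix (Fin N) (Fin N) ℂ) x.toKIdx)
    (X₁ : ∀ x : MemberY θ.d₆ θ.ℓ₆ θ.hd' θ.hL' θ.b₀ θ.b₁ Mstar, (E₁ x).Walk → ℕ → (geo9Y x).Site → Prop)
    (M₁ : ∀ x : MemberY θ.d₆ θ.ℓ₆ θ.hd' θ.hL' θ.b₀ θ.b₁ Mstar, (E₁ x).Walk → ℕ → Prop)
    (X₂ : ∀ x : MemberY θ.d₆ θ.ℓ₆ θ.hd' θ.hL' θ.b₀ θ.b₁ Mstar, (E₂ x).Walk → ℕ → (geo9Y x).Site → Prop)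
    (M₂ : ∀ x : MemberY θ.d₆ θ.ℓ₆ θ.hd' θ.hL' θ.b₀ θ.b₁ Mstar, (E₂ x).Walk → ℕ → Prop)
    (diam : MemberY θ.d₆ θ.ℓ₆ θ.hd' θ.hL' θ.b₀ θ.b₁ Mstar → ℝ) (r₀ : ℝ) (hr : ∀ x, diam x ≤ r₀)
    (near₁ : ∀ (x : MemberY θ.d₆ θ.ℓ₆ θ.hd' θ.hL' θ.b₀ θ.b₁ Mstar) ω m p, M₁ x ω m → X₁ x ω m p →
      ∃ q, q ∈ OmegaC x.D x.D' ∧ tdistK (ℓ := θ.ℓ₆) (Mh := x.Mh) (k := x.k) (P := x.P') (kLab x p) q ≤ diam x)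
    (first₁ : ∀ (x : MemberY θ.d₆ θ.ℓ₆ θ.hd' θ.hL' θ.b₀ θ.b₁ Mstar) ω y, (E₁ x).first ω y → X₁ x ω 0 y)
    (chain₁ : ∀ (x : MemberY θ.d₆ θ.ℓ₆ θ.hd' θ.hL' θ.b₀ θ.b₁ Mstar) ω y y', (E₁ x).first ω y → (E₁ x).last ω y' →
      ∃ l : List (geo9Y x).Site, l.length = (E₁ x).wlen ω ∧ (∀ (m : ℕ) (hm : m < l.length), X₁ x ω (m + 1) (l[m])) ∧
        B9Thm314.chainSum (geo9Y x).dist y l y' ≤ (E₁ x).wdist ω y y')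
    (near₂ : ∀ (x : MemberY θ.d₆ θ.ℓ₆ θ.hd' θ.hL' θ.b₀ θ.b₁ Mstar) ω m p, M₂ x ω m → X₂ x ω m p →
      ∃ q, q ∈ OmegaC x.D x.D' ∧ tdistK (ℓ := θ.ℓ₆) (Mh := x.Mh) (k := x.k) (P := x.P') (kLab x p) q ≤ diam x)
    (first₂ : ∀ (x : MemberY θ.d₆ θ.ℓ₆ θ.hd' θ.hL' θ.b₀ θ.b₁ Mstar) ω y, (E₂ x).first ω y → X₂ x ω 0 y)
    (chain₂ : ∀ (x : MemberY θ.d₆ θ.ℓ₆ θ.hd' θ.hL' θ.b₀ θ.b₁ Mstar) ω y y', (E₂ x).first ω y → (E₂ x).last ω y' →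
      ∃ l : List (geo9Y x).Site, l.length = (E₂ x).wlen ω ∧ (∀ (m : ℕ) (hm : m < l.length), X₂ x ω (m + 1) (l[m])) ∧
        B9Thm314.chainSum (geo9Y x).dist y l y' ≤ (E₂ x).wdist ω y y')
    (h₁ : Thm310AllNormsPrinted c35Y geo9Y (bg9Y (Matrix (Fin N) (Fin N) ℂ) (specialUnitaryUnits (Fin N))) E₁
      (fun x ω => kernelFamilyB x.toKIdx (bg9Y (Matrix (Fin N) (Fin N) ℂ) (specialUnitaryUnits (Fin N)) x) (fun U => U) (T₁ x ω)
        (lettersYOfRecordV4 N θ Mstar 𝔯 x).parB))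
    (h₂ : Thm310AllNormsPrinted c35Y geo9Y (bg9Y (Matrix (Fin N) (Fin N) ℂ) (specialUnitaryUnits (Fin N))) E₂
      (fun x ω => kernelFamilyB x.toKIdx (bg9Y (Matrix (Fin N) (Fin N) ℂ) (specialUnitaryUnits (Fin N)) x) (fun U => U) (T₂ x ω)
        (lettersYOfRecordV4 N θ Mstar 𝔯 x).parB))
    (W₁ : ∀ x : MemberY θ.d₆ θ.ℓ₆ θ.hd' θ.hL' θ.b₀ θ.b₁ Mstar, ℕ → (geo9Y x).Site → (geo9Y x).Site → Finset (E₁ x).Walk)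
    (W₂ : ∀ x : MemberY θ.d₆ θ.ℓ₆ θ.hd' θ.hL' θ.b₀ θ.b₁ Mstar, ℕ → (geo9Y x).Site → (geo9Y x).Site → Finset (E₂ x).Walk)
    (hW₁ : ∀ x, WalkSetsSpec (E₁ x) (W₁ x)) (hW₂ : ∀ x, WalkSetsSpec (E₂ x) (W₂ x))
    (hcnt₁ : WalkWeightsSummable geo9Y (bg9Y (Matrix (Fin N) (Fin N) ℂ) (specialUnitaryUnits (Fin N))) E₁ W₁)
    (hcnt₂ : WalkWeightsSummable geo9Y (bg9Y (Matrix (Fin N) (Fin N) ℂ) (specialUnitaryUnits (Fin N))) E₂ W₂)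
    (hexp : ∀ (x : MemberY θ.d₆ θ.ℓ₆ θ.hd' θ.hL' θ.b₀ θ.b₁ Mstar) (U : (bg9Y (Matrix (Fin N) (Fin N) ℂ) (specialUnitaryUnits (Fin N)) x).Cfg),
      (E₁ x).Converges U ∧ (E₂ x).Converges U →
      ExpansionReads x.toKIdx (B := bg9Y (Matrix (Fin N) (Fin N) ℂ) (specialUnitaryUnits (Fin N)) x) (fun U => U)
        (KdiffSY (Matrix (Fin N) (Fin N) ℂ) x)
        (pairOp (locDataY x (E₁ x) (X₁ x) (M₁ x) (diam x)).Touches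
          (locData₂ (locDataY x (E₁ x) (X₁ x) (M₁ x) (diam x)) (X₂ x) (M₂ x)).Touches (T₁ x) (T₂ x))
        (pairWalkSets (W₁ x) (W₂ x) (locDataY x (E₁ x) (X₁ x) (M₁ x) (diam x)).Touches
          (locData₂ (locDataY x (E₁ x) (X₁ x) (M₁ x) (diam x)) (X₂ x) (M₂ x)).Touches) U) :
    B9.Thm314Printed c35Y geo9Y (bg9Y (Matrix (Fin N) (Fin N) ℂ) (specialUnitaryUnits (Fin N)))
        (fun x => (opsYOfRecordV4E N θ Mstar 𝔯 𝔢 𝔴 𝔈 x).Kdiff) dOmegaY ∧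
      B9Thm314.Thm314LocalPrinted c35Y geo9Y (bg9Y (Matrix (Fin N) (Fin N) ℂ) (specialUnitaryUnits (Fin N)))
        (fun x => (opsYOfRecordV4E N θ Mstar 𝔯 𝔢 𝔴 𝔈 x).Kdiff) OmKY dOmegaY :=
  thm314_pair_layerOfLetters (lettersYOfRecordV4 N θ Mstar 𝔯) 𝔈 T₁ T₂ (fun x => locDataY x (E₁ x) (X₁ x) (M₁ x) (diam x)) X₂ M₂
    (fun x => locDataY_laws x (E₁ x) (near₁ x) (first₁ x) (chain₁ x))
    (fun x => locDataY_laws x (E₂ x) (near₂ x) (first₂ x) (chain₂ x)) r₀ hr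
    (fun x => modelSignsOn_geo9K x.toKIdx) (fun x y y' => dOmegaY_nonneg x y y') h₁ h₂ W₁ W₂ hW₁ hW₂ hcnt₁ hcnt₂ hexp

/-- ★★ **ROWS 22 ∧ 23 AT def-Y v4's INSTANCE OF RECORD FROM PER-SEQUENCE EXPANSION READINGS AND THE CANCELLATION**: `thm314_pair_opsYOfRecordV4E` with
the second expansion's terms taken with the sign of the difference (`negOp`) and its `hexp` binder SUPPLIED by
`B9Thm314WholeCancellationPair.expansionReads_sub_of_cancel` — displayed instead: `hE₁ hE₂` (the (3.107) expansions of G(U) for the member's two domain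
sequences `GAv4Y … x.toKIdx`, `GAsndSY … x` read on the read sets over their full walk sets, eventual form, under «the expansion converges at U») and
`hcancel` (the inner walk terms of the two expansions agree, p. 427).  NOT a node discharge.
[cite: Balaban1985BackgroundPropagators, Thm 3.14 (3.154) pp.426–427 + its proof p.427] -/
theorem thm314_pair_opsYOfRecordV4E_of_cancel
    {E₁ E₂ : ∀ x : MemberY θ.d₆ θ.ℓ₆ θ.hd' θ.hL' θ.b₀ θ.b₁ Mstar,
      B9.RWExpansion (geo9Y x) (bg9Y (Matrix (Fin N) (Fin N) ℂ) (specialUnitaryUnits (Fin N)) x)}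
    (T₁ : ∀ x : MemberY θ.d₆ θ.ℓ₆ θ.hd' θ.hL' θ.b₀ θ.b₁ Mstar, (E₁ x).Walk → BondOpY (Matrix (Fin N) (Fin N) ℂ) x.toKIdx)
    (T₂ : ∀ x : MemberY θ.d₆ θ.ℓ₆ θ.hd' θ.hL' θ.b₀ θ.b₁ Mstar, (E₂ x).Walk → BondOpY (Matrix (Fin N) (Fin N) ℂ) x.toKIdx)
    (X₁ : ∀ x : MemberY θ.d₆ θ.ℓ₆ θ.hd' θ.hL' θ.b₀ θ.b₁ Mstar, (E₁ x).Walk → ℕ → (geo9Y x).Site → Prop)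
    (M₁ : ∀ x : MemberY θ.d₆ θ.ℓ₆ θ.hd' θ.hL' θ.b₀ θ.b₁ Mstar, (E₁ x).Walk → ℕ → Prop)
    (X₂ : ∀ x : MemberY θ.d₆ θ.ℓ₆ θ.hd' θ.hL' θ.b₀ θ.b₁ Mstar, (E₂ x).Walk → ℕ → (geo9Y x).Site → Prop)
    (M₂ : ∀ x : MemberY θ.d₆ θ.ℓ₆ θ.hd' θ.hL' θ.b₀ θ.b₁ Mstar, (E₂ x).Walk → ℕ → Prop)
    (diam : MemberY θ.d₆ θ.ℓ₆ θ.hd' θ.hL' θ.b₀ θ.b₁ Mstar → ℝ) (r₀ : ℝ) (hr : ∀ x, diam x ≤ r₀)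
    (near₁ : ∀ (x : MemberY θ.d₆ θ.ℓ₆ θ.hd' θ.hL' θ.b₀ θ.b₁ Mstar) ω m p, M₁ x ω m → X₁ x ω m p →
      ∃ q, q ∈ OmegaC x.D x.D' ∧ tdistK (ℓ := θ.ℓ₆) (Mh := x.Mh) (k := x.k) (P := x.P') (kLab x p) q ≤ diam x)
    (first₁ : ∀ (x : MemberY θ.d₆ θ.ℓ₆ θ.hd' θ.hL' θ.b₀ θ.b₁ Mstar) ω y, (E₁ x).first ω y → X₁ x ω 0 y)
    (chain₁ : ∀ (x : MemberY θ.d₆ θ.ℓ₆ θ.hd' θ.hL' θ.b₀ θ.b₁ Mstar) ω y y', (E₁ x).first ω y → (E₁ x).last ω y' →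
      ∃ l : List (geo9Y x).Site, l.length = (E₁ x).wlen ω ∧ (∀ (m : ℕ) (hm : m < l.length), X₁ x ω (m + 1) (l[m])) ∧
        B9Thm314.chainSum (geo9Y x).dist y l y' ≤ (E₁ x).wdist ω y y')
    (near₂ : ∀ (x : MemberY θ.d₆ θ.ℓ₆ θ.hd' θ.hL' θ.b₀ θ.b₁ Mstar) ω m p, M₂ x ω m → X₂ x ω m p →
      ∃ q, q ∈ OmegaC x.D x.D' ∧ tdistK (ℓ := θ.ℓ₆) (Mh := x.Mh) (k := x.k) (P := x.P') (kLab x p) q ≤ diam x)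
    (first₂ : ∀ (x : MemberY θ.d₆ θ.ℓ₆ θ.hd' θ.hL' θ.b₀ θ.b₁ Mstar) ω y, (E₂ x).first ω y → X₂ x ω 0 y)
    (chain₂ : ∀ (x : MemberY θ.d₆ θ.ℓ₆ θ.hd' θ.hL' θ.b₀ θ.b₁ Mstar) ω y y', (E₂ x).first ω y → (E₂ x).last ω y' →
      ∃ l : List (geo9Y x).Site, l.length = (E₂ x).wlen ω ∧ (∀ (m : ℕ) (hm : m < l.length), X₂ x ω (m + 1) (l[m])) ∧
        B9Thm314.chainSum (geo9Y x).dist y l y' ≤ (E₂ x).wdist ω y y')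
    (h₁ : Thm310AllNormsPrinted c35Y geo9Y (bg9Y (Matrix (Fin N) (Fin N) ℂ) (specialUnitaryUnits (Fin N))) E₁
      (fun x ω => kernelFamilyB x.toKIdx (bg9Y (Matrix (Fin N) (Fin N) ℂ) (specialUnitaryUnits (Fin N)) x) (fun U => U) (T₁ x ω)
        (lettersYOfRecordV4 N θ Mstar 𝔯 x).parB))
    (h₂ : Thm310AllNormsPrinted c35Y geo9Y (bg9Y (Matrix (Fin N) (Fin N) ℂ) (specialUnitaryUnits (Fin N))) E₂
      (fun x ω => kernelFamilyB x.toKIdx (bg9Y (Matrix (Fin N) (Fin N) ℂ) (specialUnitaryUnits (Fin N)) x) (fun U => U) (negOp (T₂ x) ω)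
        (lettersYOfRecordV4 N θ Mstar 𝔯 x).parB))
    (W₁ : ∀ x : MemberY θ.d₆ θ.ℓ₆ θ.hd' θ.hL' θ.b₀ θ.b₁ Mstar, ℕ → (geo9Y x).Site → (geo9Y x).Site → Finset (E₁ x).Walk)
    (W₂ : ∀ x : MemberY θ.d₆ θ.ℓ₆ θ.hd' θ.hL' θ.b₀ θ.b₁ Mstar, ℕ → (geo9Y x).Site → (geo9Y x).Site → Finset (E₂ x).Walk)
    (hW₁ : ∀ x, WalkSetsSpec (E₁ x) (W₁ x)) (hW₂ : ∀ x, WalkSetsSpec (E₂ x) (W₂ x))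
    (hcnt₁ : WalkWeightsSummable geo9Y (bg9Y (Matrix (Fin N) (Fin N) ℂ) (specialUnitaryUnits (Fin N))) E₁ W₁)
    (hcnt₂ : WalkWeightsSummable geo9Y (bg9Y (Matrix (Fin N) (Fin N) ℂ) (specialUnitaryUnits (Fin N))) E₂ W₂)
    (hE₁ : ∀ (x : MemberY θ.d₆ θ.ℓ₆ θ.hd' θ.hL' θ.b₀ θ.b₁ Mstar) (U : (bg9Y (Matrix (Fin N) (Fin N) ℂ) (specialUnitaryUnits (Fin N)) x).Cfg),
      (E₁ x).Converges U → ExpansionReadsEv (B := bg9Y (Matrix (Fin N) (Fin N) ℂ) (specialUnitaryUnits (Fin N)) x) (fun U => U)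
        (GAv4Y (Matrix (Fin N) (Fin N) ℂ) x.toKIdx) (T₁ x) (W₁ x) U)
    (hE₂ : ∀ (x : MemberY θ.d₆ θ.ℓ₆ θ.hd' θ.hL' θ.b₀ θ.b₁ Mstar) (U : (bg9Y (Matrix (Fin N) (Fin N) ℂ) (specialUnitaryUnits (Fin N)) x).Cfg),
      (E₂ x).Converges U → ExpansionReadsEv (B := bg9Y (Matrix (Fin N) (Fin N) ℂ) (specialUnitaryUnits (Fin N)) x) (fun U => U)
        (GAsndSY (Matrix (Fin N) (Fin N) ℂ) x) (T₂ x) (W₂ x) U)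
    (hcancel : ∀ (x : MemberY θ.d₆ θ.ℓ₆ θ.hd' θ.hL' θ.b₀ θ.b₁ Mstar) (U : (bg9Y (Matrix (Fin N) (Fin N) ℂ) (specialUnitaryUnits (Fin N)) x).Cfg),
      InnerTermsAgree (W₁ x) (W₂ x) (locDataY x (E₁ x) (X₁ x) (M₁ x) (diam x)).Touches
        (locData₂ (locDataY x (E₁ x) (X₁ x) (M₁ x) (diam x)) (X₂ x) (M₂ x)).Touches (T₁ x) (T₂ x) U) :
    B9.Thm314Printed c35Y geo9Y (bg9Y (Matrix (Fin N) (Fin N) ℂ) (specialUnitaryUnits (Fin N)))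
        (fun x => (opsYOfRecordV4E N θ Mstar 𝔯 𝔢 𝔴 𝔈 x).Kdiff) dOmegaY ∧
      B9Thm314.Thm314LocalPrinted c35Y geo9Y (bg9Y (Matrix (Fin N) (Fin N) ℂ) (specialUnitaryUnits (Fin N)))
        (fun x => (opsYOfRecordV4E N θ Mstar 𝔯 𝔢 𝔴 𝔈 x).Kdiff) OmKY dOmegaY :=
  thm314_pair_opsYOfRecordV4E N θ Mstar 𝔯 𝔢 𝔴 𝔈 T₁ (fun x => negOp (T₂ x)) X₁ M₁ X₂ M₂ diam r₀ hr near₁ first₁ chain₁ near₂ first₂ chain₂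
    h₁ h₂ W₁ W₂ hW₁ hW₂ hcnt₁ hcnt₂ fun x U hU => expansionReads_sub_of_cancel (hE₁ x U hU.1) (hE₂ x U hU.2) (hcancel x U)

/-! ## §2 Row 24 at the v4 record through the expansion slot -/

/-- ★★ **ROW 24 (`t315`) OF THE N06 CERTIFICATE AT def-Y v4's INSTANCE OF RECORD `opsYOfRecordV4E N θ M⋆ 𝔯 𝔢 𝔴 𝔈`, THROUGH THE EXPANSION SLOT** — the
binder VERBATIM (the left-hand side of def-Y's `t315_opsYOfRecordV4E_iff`), the bound (3.187) PROVED (`B9Thm315WholeSectE.t315_opsYSectE_of_reading` at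
`ops := opsYS349OfRecordV4 …`, `𝔏 := lettersYOfRecordV4 …`).  Displayed: the two pinned slots on the printed prefix (`h`: the (3.185) identity over
`lettersYOfRecordV4 … x` and the expansion clause at rate `δ₁`), the located kernel reading `hread` (`KernelDominated` for the kernel of `CkY` over
`lettersYOfRecordV4 … x`), the walk data `W hW hwd hcnt`, uniform term constants `C₀ c₀`, the floor `2D₀c₀ ≤ M⋆`; OUTPUT δ₀ = δ′, a₀, B₀ = 2N₀C₀.
[cite: Balaban1985BackgroundPropagators, Thm 3.15 (3.185)–(3.187) p.432, Thm 3.9 (3.98)–(3.99) p.413, Cor. 3.8 (3.91) p.410] -/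
theorem t315_opsYOfRecordV4E_of_reading
    {a₀ δ₁ δ' C₀ c₀ N₀ D₀ : ℝ} (ha₀ : 0 < a₀) (hδ' : 0 < δ') (hδ'₁ : δ' ≤ δ₁) (hC₀ : 0 < C₀) (hc₀ : 0 < c₀) (hN₀ : 0 < N₀)
    (hD₀ : 0 < D₀) (hC : ∀ x, (𝔴 x).C ≤ C₀) (hc : ∀ x, (𝔴 x).c ≤ c₀)
    (W : ∀ x : MemberY θ.d₆ θ.ℓ₆ θ.hd' θ.hL' θ.b₀ θ.b₁ Mstar, ℕ → (geo9Y x).Site → (geo9Y x).Site → Finset (𝔴 x).EC.Walk)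
    (hW : ∀ (x : MemberY θ.d₆ θ.ℓ₆ θ.hd' θ.hL' θ.b₀ θ.b₁ Mstar) (n : ℕ) (y y' : (geo9Y x).Site) (ω : (𝔴 x).EC.Walk),
      ω ∈ W x n y y' → (𝔴 x).EC.wlen ω = n)
    (hwd : ∀ (x : MemberY θ.d₆ θ.ℓ₆ θ.hd' θ.hL' θ.b₀ θ.b₁ Mstar) (ω : (𝔴 x).EC.Walk) (y y' : (geo9Y x).Site), 0 ≤ (𝔴 x).EC.wdist ω y y')
    (hcnt : ∀ x : MemberY θ.d₆ θ.ℓ₆ θ.hd' θ.hL' θ.b₀ θ.b₁ Mstar, KWalkCount (𝔴 x).EC (W x) (inΛY x) (unitDistY x) N₀ D₀ δ₁ δ')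
    (hM : 2 * D₀ * c₀ ≤ (Mstar : ℝ))
    (h : ∀ (x : MemberY θ.d₆ θ.ℓ₆ θ.hd' θ.hL' θ.b₀ θ.b₁ Mstar) (α₀ : ℝ), 0 < α₀ → (geo9Y x).M * α₀ ≤ a₀ →
      ∀ U : (bg9Y (Matrix (Fin N) (Fin N) ℂ) (specialUnitaryUnits (Fin N)) x).Cfg,
        (bg9Y (Matrix (Fin N) (Fin N) ℂ) (specialUnitaryUnits (Fin N)) x).Reg335 c35Y α₀ U →
        (bg9Y (Matrix (Fin N) (Fin N) ℂ) (specialUnitaryUnits (Fin N)) x).Reg336 c35Y α₀ U →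
          givenBy3185Y x (lettersYOfRecordV4 N θ Mstar 𝔯 x) (𝔢 x) U ∧ hasRWExpCY (𝔴 x) U δ₁)
    (hread : ∀ (x : MemberY θ.d₆ θ.ℓ₆ θ.hd' θ.hL' θ.b₀ θ.b₁ Mstar) (U : (bg9Y (Matrix (Fin N) (Fin N) ℂ) (specialUnitaryUnits (Fin N)) x).Cfg),
      (𝔴 x).EC.Converges U →
        KernelDominated (𝔴 x).EC (siteKernelOfOp x.toKIdx (bg9Y (Matrix (Fin N) (Fin N) ℂ) (specialUnitaryUnits (Fin N)) x) (fun U => U)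
          (CkY x (lettersYOfRecordV4 N θ Mstar 𝔯 x) (𝔢 x)) id id) (inΛY x) (W x) U) :
    B9.Thm315FullPrinted c35Y geo9Y (bg9Y (Matrix (Fin N) (Fin N) ℂ) (specialUnitaryUnits (Fin N)))
      (fun x => (opsYOfRecordV4E N θ Mstar 𝔯 𝔢 𝔴 𝔈 x).Ck) inΛY unitDistY
      (fun x => (opsYOfRecordV4E N θ Mstar 𝔯 𝔢 𝔴 𝔈 x).GivenBy3185) (fun x => (opsYOfRecordV4E N θ Mstar 𝔯 𝔢 𝔴 𝔈 x).HasRWExpC) :=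
  t315_opsYSectE_of_reading N θ Mstar (opsYS349OfRecordV4 N θ Mstar 𝔯 𝔈) (lettersYOfRecordV4 N θ Mstar 𝔯) 𝔢 𝔴
    ha₀ hδ' hδ'₁ hC₀ hc₀ hN₀ hD₀ hC hc W hW hwd hcnt hM h hread

end Literature.MathematicalPhysics.QuantumFieldTheory.Balaban1983to89.B9Thm314Thm315RecordV4

end
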